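import Mathlib
import HarnessLib

/-!
# "Agreement AT EVERY β" with INDEPENDENT couplings: the exact product law of a whole A-versus-B
# table, the Šidák per-column level, and the number the `1σ_comb` rule implies — seven independent
# columns each calibrated at `N(0,1)([−1, 1])` agree SIMULTANEOUSLY with asymptotic probability
# `N(0,1)([−1, 1])⁷ < 0.075`

HONEST FRAMING: exact (Metropolis-corrected) sampling algorithms for lattice gauge theory;
figures of merit are autocorrelation/cost numbers at stated couplings and volumes; no
continuum-physics claim.

Venture `LatticeQCDFlow` (cell pub-lqcd), topic `Scoring`; FANOUT row 4 (`s0-u1-b`, rung S0-B: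
"acceptance A vs B within 3 pp at every β; τ_int(Q) A vs B within 1σ_comb").  The cell's two-code
theorems calibrate ONE column of the table: when the two codes are both exact the criterion
"within `z` combined error bars" holds with probability `→ c(z) = N(0,1)([−z, z])`
(`Scoring/AsymptoticCoverage`, `Scoring/DoeblinPowerTwoChainAgreementCoverage`, …), and
`Scoring/SimultaneousAgreement` gave the table-level Bonferroni LOWER bound `1 − Σ_j (1 − c_j)`,
which needs no independence but is vacuous for the card's numbers (`k = 7` couplings at `z = 1`:
`1 − 7·(1 − 0.683) < 0`).  The runs at DIFFERENT couplings are separate jobs with separate seeds,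
i.e. INDEPENDENT, and then the table-level probability is known EXACTLY: on the product of the `k`
column spaces the event "every column agrees" has probability `∏_j P_j(E_j)` (finite sample,
**`measureReal_pi_forall_mem`**), hence `→ ∏_j c_j` when column `j` is asymptotically calibrated at
`c_j` (**`tendsto_measureReal_pi_forall_mem`**), `= c^k` at a common level
(**`tendsto_measureReal_pi_forall_mem_const`**).  Read for the row's own acceptance sentence: with
the `1σ_comb` rule at each of `k = 7` independent couplings, two EXACT codes pass the whole table
with asymptotic probability `c(1)⁷`, and `c(1) ≤ 0.69` (**`gaussianReal_real_Icc_one_le`**, from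
`e^{−u} ≤ 1 − u + u²/2 + (2/9)u³` on `[0, 1]` and `π > 3.14`) gives `c(1)⁷ < 0.075`
(**`gaussianReal_real_Icc_one_pow_seven_lt`**; the true value is `≈ 0.069`): the criterion AS
WORDED is failed by two correct codes more than eleven times in twelve
(**`sevenColumns_oneSigma_eventually_lt`**).  The standard repair is Šidák's per-column level
`(1 − α)^{1/k}`, whose `k`-th power is exactly the table level `1 − α`
(**`sidak_level_pow`**); Bonferroni's `1 − α/k` is the more demanding per-column level
(**`sidak_level_le_bonferroni`**, Bernoulli's inequality), i.e. conservative under independence.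
Also the crude all-`z` ceiling `c(z) ≤ 2z/√(2π)` (**`gaussianReal_real_Icc_le`**).  NEW WORK of
the cell (textbook probability; our formalisation); no definition; nothing cited as a fact.
Printed counterparts NAMED ONLY: Šidák (1967), Bonferroni; nothing cited.

## Content

* **`measureReal_pi_forall_mem`** — `(⨂_j P_j){ω | ∀ j, ω_j ∈ E_j} = ∏_j P_j(E_j)`;
* **`tendsto_measureReal_pi_forall_mem`**, **`tendsto_measureReal_pi_forall_mem_const`**;
* **`sidak_level_pow`**, **`sidak_level_le_bonferroni`**;
* `exp_neg_le_cubicPoly`, `gaussianPDFReal_std_le`, **`gaussianReal_real_Icc_le`**,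
  **`gaussianReal_real_Icc_one_le`**, **`gaussianReal_real_Icc_one_pow_seven_lt`**;
* **`sevenColumns_oneSigma_eventually_lt`** — the row's sentence: seven independent columns, each
  asymptotically at the `1σ` level ⇒ eventually `P(all seven agree) < 0.075`;
* **`prod_one_sub_le_measureReal_pi_forall_mem`** (finite sample: per-column certificates
  multiply), `one_sub_sum_le_prod_one_sub` (Weierstrass: never weaker than Bonferroni).

NOT CLAIMED: dependence between columns of ONE coupling (several observables of the same pair of
runs — that needs their joint limit, `Scoring/MarkovChainMultivariateCLT`); the numerical per-column
`z` that Šidák's level requires (an inverse-Gaussian evaluation, not done here); lower bounds on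
`c(z)`; any number of ours.
-/

noncomputable section

namespace Summit.Ventures.LatticeQCDFlow.Scoring.CardConsistency

open MeasureTheory ProbabilityTheory Filter Finset Set
open scoped Topology ENNReal NNReal

/-! ## §1 The product law of a table with independent columns -/

section ProductLaw

variable {ι : Type*} [Fintype ι] {Ω : ι → Type*} [∀ j, MeasurableSpace (Ω j)]
  (P : ∀ j, Measure (Ω j)) [∀ j, IsProbabilityMeasure (P j)]

/-- **Exact finite-sample product law.**  On the product of the column spaces (independent
columns), the event "column `j` agrees for every `j`" has probability `∏_j P_j(E_j)` — for
arbitrary (not necessarily measurable) events. [ours] -/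
theorem measureReal_pi_forall_mem (E : ∀ j, Set (Ω j)) :
    (Measure.pi P).real {ω : ∀ j, Ω j | ∀ j, ω j ∈ E j} = ∏ j, (P j).real (E j) := by
  have hset : {ω : ∀ j, Ω j | ∀ j, ω j ∈ E j} = Set.pi univ E := by
    ext ω; simp
  rw [measureReal_def, hset, Measure.pi_pi]
  rw [ENNReal.toReal_prod]
  rfl

/-- **Asymptotic product law.**  If column `j`'s agreement event `Eₙ^j` has probability `→ c_j`
for every `j`, then the probability that ALL columns agree tends to `∏_j c_j`. [ours] -/
theorem tendsto_measureReal_pi_forall_mem {E : ℕ → ∀ j, Set (Ω j)} {c : ι → ℝ}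
    (h : ∀ j, Tendsto (fun n => (P j).real (E n j)) atTop (𝓝 (c j))) :
    Tendsto (fun n => (Measure.pi P).real {ω : ∀ j, Ω j | ∀ j, ω j ∈ E n j}) atTop
      (𝓝 (∏ j, c j)) := by
  simp_rw [measureReal_pi_forall_mem]
  exact tendsto_finsetProd _ fun j _ => h j

/-- **Common per-column level.**  If every column is asymptotically calibrated at the same level
`c`, the whole table of `k = |ι|` independent columns agrees with probability `→ c^k`. [ours] -/
theorem tendsto_measureReal_pi_forall_mem_const {E : ℕ → ∀ j, Set (Ω j)} {c : ℝ}
    (h : ∀ j, Tendsto (fun n => (P j).real (E n j)) atTop (𝓝 c)) :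
    Tendsto (fun n => (Measure.pi P).real {ω : ∀ j, Ω j | ∀ j, ω j ∈ E n j}) atTop
      (𝓝 (c ^ Fintype.card ι)) := by
  have := tendsto_measureReal_pi_forall_mem P h
  rwa [Finset.prod_const, Finset.card_univ] at this

end ProductLaw

/-! ## §2 Šidák's per-column level and its comparison with Bonferroni's -/

section Sidak

/-- **Šidák's level.**  For a table level `1 − α ≥ 0` and `k ≠ 0` independent columns, the
per-column level `(1 − α)^{1/k}` has `k`-th power exactly `1 − α`. [ours] -/
theorem sidak_level_pow {α : ℝ} (hα : α ≤ 1) {k : ℕ} (hk : k ≠ 0) :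
    ((1 - α) ^ ((k : ℝ)⁻¹)) ^ k = 1 - α :=
  Real.rpow_inv_natCast_pow (by linarith) hk

/-- **Bonferroni is conservative under independence**: `1 − α ≤ (1 − α/k)^k` (Bernoulli), so
Šidák's per-column level is at most Bonferroni's, `(1 − α)^{1/k} ≤ 1 − α/k`
(`α ≤ 1`, `k ≠ 0`). [ours] -/
theorem sidak_level_le_bonferroni {α : ℝ} (hα1 : α ≤ 1) {k : ℕ} (hk : k ≠ 0) :
    1 - α ≤ (1 - α / k) ^ k ∧ (1 - α) ^ ((k : ℝ)⁻¹) ≤ 1 - α / k := by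
  have hk1 : (1 : ℝ) ≤ k := by exact_mod_cast Nat.one_le_iff_ne_zero.2 hk
  have hkpos : (0 : ℝ) < k := by linarith
  have hbern : 1 - α ≤ (1 - α / k) ^ k := by
    have h := one_add_mul_le_pow (a := -(α / k)) (by
      have : α / k ≤ 1 := by rw [div_le_one hkpos]; linarith
      linarith) k
    have hk' : (k : ℝ) * -(α / k) = -α := by field_simp
    rw [hk'] at h
    simpa [sub_eq_add_neg] using h
  refine ⟨hbern, ?_⟩
  have hB0 : 0 ≤ 1 - α / k := by
    rw [sub_nonneg, div_le_one hkpos]; linarith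
  calc (1 - α) ^ ((k : ℝ)⁻¹) ≤ ((1 - α / k) ^ k) ^ ((k : ℝ)⁻¹) :=
        Real.rpow_le_rpow (by linarith) hbern (by positivity)
    _ = 1 - α / k := Real.pow_rpow_inv_natCast hB0 hk

end Sidak

/-! ## §3 The numbers behind the `1σ_comb` rule -/

section Gaussian

/-- `e^{−u} ≤ 1 − u + u²/2 + (2/9) u³` for `0 ≤ u ≤ 1` (third-order Taylor remainder,
`Real.exp_bound`). [ours] -/
theorem exp_neg_le_cubicPoly {u : ℝ} (h0 : 0 ≤ u) (h1 : u ≤ 1) :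
    Real.exp (-u) ≤ 1 - u + u ^ 2 / 2 + 2 / 9 * u ^ 3 := by
  have hx : |(-u)| ≤ 1 := by rw [abs_neg, abs_of_nonneg h0]; exact h1
  have h := Real.exp_bound hx (n := 3) (by norm_num)
  have hsum : ∑ m ∈ Finset.range 3, (-u) ^ m / (m.factorial : ℝ) = 1 - u + u ^ 2 / 2 := by
    simp [Finset.sum_range_succ, Nat.factorial]
    ring
  rw [hsum] at h
  have h' := (abs_sub_le_iff.1 h).1
  have habs : |(-u)| ^ 3 = u ^ 3 := by rw [abs_neg, abs_of_nonneg h0]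
  rw [habs] at h'
  have hc : ((Nat.succ 3 : ℕ) : ℝ) / ((Nat.factorial 3 : ℕ) * (3 : ℕ)) = 2 / 9 := by
    norm_num [Nat.factorial]
  rw [hc] at h'
  linarith

/-- The standard Gaussian density is at most `(√(2π))⁻¹` everywhere, and at most
`(√(2π))⁻¹ (1 − x²/2 + x⁴/8 + x⁶/36)` on `[−1, 1]`. [ours] -/
theorem gaussianPDFReal_std_le (x : ℝ) :
    gaussianPDFReal 0 1 x ≤ (Real.sqrt (2 * Real.pi))⁻¹ ∧
    (|x| ≤ 1 → gaussianPDFReal 0 1 x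
      ≤ (Real.sqrt (2 * Real.pi))⁻¹ * (1 - x ^ 2 / 2 + x ^ 4 / 8 + x ^ 6 / 36)) := by
  have hpdf : gaussianPDFReal 0 1 x = (Real.sqrt (2 * Real.pi))⁻¹ * Real.exp (-(x ^ 2 / 2)) := by
    rw [gaussianPDFReal_def]
    simp only [NNReal.coe_one, mul_one, sub_zero]
    congr 1
    rw [neg_div]
  have hC : 0 ≤ (Real.sqrt (2 * Real.pi))⁻¹ := inv_nonneg.2 (Real.sqrt_nonneg _)
  refine ⟨?_, fun hx => ?_⟩
  · rw [hpdf]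
    calc (Real.sqrt (2 * Real.pi))⁻¹ * Real.exp (-(x ^ 2 / 2))
        ≤ (Real.sqrt (2 * Real.pi))⁻¹ * 1 := by
          refine mul_le_mul_of_nonneg_left ?_ hC
          rw [Real.exp_le_one_iff]
          have := sq_nonneg x
          linarith
      _ = _ := mul_one _
  · rw [hpdf]
    refine mul_le_mul_of_nonneg_left ?_ hC
    have hx2 : x ^ 2 ≤ 1 := by
      have : |x| ^ 2 ≤ 1 ^ 2 := pow_le_pow_left₀ (abs_nonneg x) hx 2
      rw [sq_abs, one_pow] at this
      exact this
    have h := exp_neg_le_cubicPoly (u := x ^ 2 / 2) (by positivity) (by linarith)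
    calc Real.exp (-(x ^ 2 / 2)) ≤ 1 - x ^ 2 / 2 + (x ^ 2 / 2) ^ 2 / 2 + 2 / 9 * (x ^ 2 / 2) ^ 3 := h
      _ = 1 - x ^ 2 / 2 + x ^ 4 / 8 + x ^ 6 / 36 := by ring

/-- **Crude all-`z` ceiling**: `N(0,1)([−z, z]) ≤ 2z/√(2π)` (`z ≥ 0`). [ours] -/
theorem gaussianReal_real_Icc_le {z : ℝ} (hz : 0 ≤ z) :
    (gaussianReal 0 1).real (Icc (-z) z) ≤ 2 * z / Real.sqrt (2 * Real.pi) := by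
  rw [measureReal_def, gaussianReal_apply_eq_integral 0 one_ne_zero,
    ENNReal.toReal_ofReal (setIntegral_nonneg measurableSet_Icc
      fun x _ => gaussianPDFReal_nonneg _ _ _)]
  calc ∫ x in Icc (-z) z, gaussianPDFReal 0 1 x
      ≤ ∫ x in Icc (-z) z, (Real.sqrt (2 * Real.pi))⁻¹ := by
        refine setIntegral_mono_on (integrable_gaussianPDFReal 0 1).integrableOn
          (integrableOn_const (by simp [Real.volume_Icc])) measurableSet_Icc fun x _ =>
          (gaussianPDFReal_std_le x).1
    _ = 2 * z / Real.sqrt (2 * Real.pi) := by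
        rw [setIntegral_const, smul_eq_mul, Real.volume_real_Icc_of_le (by linarith)]
        ring

/-- **`N(0,1)([−1, 1]) ≤ 0.69`** (true value `≈ 0.6827`). [ours] -/
theorem gaussianReal_real_Icc_one_le :
    (gaussianReal 0 1).real (Icc (-1) 1) ≤ 0.69 := by
  rw [measureReal_def, gaussianReal_apply_eq_integral 0 one_ne_zero,
    ENNReal.toReal_ofReal (setIntegral_nonneg measurableSet_Icc
      fun x _ => gaussianPDFReal_nonneg _ _ _)]
  -- bound the density by the polynomial on `[−1, 1]`
  have hpoly_cont : Continuous fun x : ℝ =>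
      (Real.sqrt (2 * Real.pi))⁻¹ * (1 - x ^ 2 / 2 + x ^ 4 / 8 + x ^ 6 / 36) := by fun_prop
  have hle : ∫ x in Icc (-1 : ℝ) 1, gaussianPDFReal 0 1 x
      ≤ ∫ x in Icc (-1 : ℝ) 1,
          (Real.sqrt (2 * Real.pi))⁻¹ * (1 - x ^ 2 / 2 + x ^ 4 / 8 + x ^ 6 / 36) := by
    refine setIntegral_mono_on (integrable_gaussianPDFReal 0 1).integrableOn
      (hpoly_cont.integrableOn_Icc) measurableSet_Icc fun x hx => (gaussianPDFReal_std_le x).2 ?_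
    exact abs_le.2 ⟨hx.1, hx.2⟩
  -- evaluate the polynomial integral
  have hval : ∫ x in Icc (-1 : ℝ) 1,
      (Real.sqrt (2 * Real.pi))⁻¹ * (1 - x ^ 2 / 2 + x ^ 4 / 8 + x ^ 6 / 36)
      = (Real.sqrt (2 * Real.pi))⁻¹ * (2 - 1 / 3 + 1 / 20 + 1 / 126) := by
    rw [integral_Icc_eq_integral_Ioc, ← intervalIntegral.integral_of_le (by norm_num),
      intervalIntegral.integral_const_mul]
    congr 1
    have h2 : ∫ x in (-1 : ℝ)..1, x ^ 2 = 2 / 3 := by rw [integral_pow]; norm_num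
    have h4 : ∫ x in (-1 : ℝ)..1, x ^ 4 = 2 / 5 := by rw [integral_pow]; norm_num
    have h6 : ∫ x in (-1 : ℝ)..1, x ^ 6 = 2 / 7 := by rw [integral_pow]; norm_num
    have hi2 : IntervalIntegrable (fun x : ℝ => x ^ 2 / 2) volume (-1) 1 :=
      (continuous_pow 2 |>.div_const _).intervalIntegrable _ _
    have hi4 : IntervalIntegrable (fun x : ℝ => x ^ 4 / 8) volume (-1) 1 :=
      (continuous_pow 4 |>.div_const _).intervalIntegrable _ _
    have hi6 : IntervalIntegrable (fun x : ℝ => x ^ 6 / 36) volume (-1) 1 :=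
      (continuous_pow 6 |>.div_const _).intervalIntegrable _ _
    have hi1 : IntervalIntegrable (fun _ : ℝ => (1 : ℝ)) volume (-1) 1 :=
      continuous_const.intervalIntegrable _ _
    rw [intervalIntegral.integral_add (hi1.sub hi2 |>.add hi4) hi6,
      intervalIntegral.integral_add (hi1.sub hi2) hi4,
      intervalIntegral.integral_sub hi1 hi2,
      intervalIntegral.integral_div, intervalIntegral.integral_div,
      intervalIntegral.integral_div, h2, h4, h6, intervalIntegral.integral_const]
    norm_num
  -- numerics: `√(2π) > 2.5` since `π > 3.14`
  have hsqrt : (2.5 : ℝ) ≤ Real.sqrt (2 * Real.pi) := by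
    refine Real.le_sqrt_of_sq_le ?_
    have := Real.pi_gt_d2
    nlinarith
  have hinv : (Real.sqrt (2 * Real.pi))⁻¹ ≤ (2.5 : ℝ)⁻¹ :=
    inv_anti₀ (by norm_num) hsqrt
  calc ∫ x in Icc (-1 : ℝ) 1, gaussianPDFReal 0 1 x
      ≤ (Real.sqrt (2 * Real.pi))⁻¹ * (2 - 1 / 3 + 1 / 20 + 1 / 126) := hle.trans hval.le
    _ ≤ (2.5 : ℝ)⁻¹ * (2 - 1 / 3 + 1 / 20 + 1 / 126) :=
        mul_le_mul_of_nonneg_right hinv (by norm_num)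
    _ ≤ 0.69 := by norm_num

/-- **Seven independent `1σ` columns: `N(0,1)([−1, 1])⁷ < 0.075`** (true value `≈ 0.069`).
[ours] -/
theorem gaussianReal_real_Icc_one_pow_seven_lt :
    (gaussianReal 0 1).real (Icc (-1) 1) ^ 7 < 0.075 := by
  have h0 : 0 ≤ (gaussianReal 0 1).real (Icc (-1) 1) := measureReal_nonneg
  calc (gaussianReal 0 1).real (Icc (-1) 1) ^ 7 ≤ (0.69 : ℝ) ^ 7 :=
        pow_le_pow_left₀ h0 gaussianReal_real_Icc_one_le 7
    _ < 0.075 := by norm_num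

end Gaussian

/-! ## §4 The row's acceptance sentence, as worded -/

section SevenColumns

variable {ι : Type*} [Fintype ι] {Ω : ι → Type*} [∀ j, MeasurableSpace (Ω j)]
  (P : ∀ j, Measure (Ω j)) [∀ j, IsProbabilityMeasure (P j)]

/-- **"A vs B within `1σ_comb` AT EVERY β", seven independent couplings, both codes exact.**  If at
each of `k = 7` independent couplings the agreement event is asymptotically calibrated at the
one-sigma Gaussian level `N(0,1)([−1, 1])` (the conclusion of the cell's coverage theorems with
`z = 1`), then the probability that the WHOLE table agrees tends to `N(0,1)([−1, 1])⁷` and is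
eventually below `0.075`: two correct codes fail the criterion as worded more than eleven times in
twelve. [ours] -/
theorem sevenColumns_oneSigma_eventually_lt (hk : Fintype.card ι = 7) {E : ℕ → ∀ j, Set (Ω j)}
    (h : ∀ j, Tendsto (fun n => (P j).real (E n j)) atTop
      (𝓝 ((gaussianReal 0 1).real (Icc (-1) 1)))) :
    Tendsto (fun n => (Measure.pi P).real {ω : ∀ j, Ω j | ∀ j, ω j ∈ E n j}) atTop
      (𝓝 ((gaussianReal 0 1).real (Icc (-1) 1) ^ 7)) ∧
    ∀ᶠ n in atTop, (Measure.pi P).real {ω : ∀ j, Ω j | ∀ j, ω j ∈ E n j} < 0.075 := by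
  have ht := tendsto_measureReal_pi_forall_mem_const P h
  rw [hk] at ht
  exact ⟨ht, ht.eventually (gt_mem_nhds gaussianReal_real_Icc_one_pow_seven_lt)⟩

end SevenColumns

/-! ## §5 Finite-sample form: per-column certificates MULTIPLY under independence -/

section Certificates

variable {ι : Type*} [Fintype ι] {Ω : ι → Type*} [∀ j, MeasurableSpace (Ω j)]
  (P : ∀ j, Measure (Ω j)) [∀ j, IsProbabilityMeasure (P j)]

/-- **Per-column finite-sample certificates multiply.**  If column `j` agrees except with
probability at most `η_j ≤ 1` (any one-column certificate: `Scoring/TwoCodeUnionBound` fed with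
Hoeffding / Doeblin-chain / reweighting tails), then with independent columns the whole table
agrees with probability at least `∏_j (1 − η_j)`. [ours] -/
theorem prod_one_sub_le_measureReal_pi_forall_mem {E : ∀ j, Set (Ω j)} {η : ι → ℝ}
    (hη : ∀ j, η j ≤ 1) (h : ∀ j, 1 - η j ≤ (P j).real (E j)) :
    ∏ j, (1 - η j) ≤ (Measure.pi P).real {ω : ∀ j, Ω j | ∀ j, ω j ∈ E j} := by
  rw [measureReal_pi_forall_mem]
  exact Finset.prod_le_prod (fun j _ => by linarith [hη j]) fun j _ => h j

omit [Fintype ι] in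
/-- **Weierstrass' product inequality**: `1 − Σ_{j∈s} η_j ≤ ∏_{j∈s} (1 − η_j)` for
`η_j ∈ [0, 1]` — the independence bound is never weaker than Bonferroni's
(`Scoring/SimultaneousAgreement.one_sub_sum_le_measureReal_biInter`). [folklore] -/
theorem one_sub_sum_le_prod_one_sub (s : Finset ι) {η : ι → ℝ} (h0 : ∀ j, 0 ≤ η j)
    (h1 : ∀ j, η j ≤ 1) :
    1 - ∑ j ∈ s, η j ≤ ∏ j ∈ s, (1 - η j) := by
  classical
  induction s using Finset.induction_on with
  | empty => simp
  | insert a s ha ih =>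
    rw [Finset.sum_insert ha, Finset.prod_insert ha]
    have hs0 : 0 ≤ ∑ j ∈ s, η j := Finset.sum_nonneg fun j _ => h0 j
    have ha1 : 0 ≤ 1 - η a := by linarith [h1 a]
    calc 1 - (η a + ∑ j ∈ s, η j)
        ≤ (1 - η a) * (1 - ∑ j ∈ s, η j) := by nlinarith [h0 a]
      _ ≤ (1 - η a) * ∏ j ∈ s, (1 - η j) := mul_le_mul_of_nonneg_left ih ha1

end Certificates

end Summit.Ventures.LatticeQCDFlow.Scoring.CardConsistency

end
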